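/-
Copyright (c) 2026 the pub-hodgecm-mathlib formalisation cell (harness21).  Prover seat hodgecm-mathlib-LH4-p08 (g8), req620 Track A «(D-RAM) FOUR-FRAME» squad, helper lane
on h413 = stmt-HodgeConjecture-24833 (count-neutral).  STAGE-1b, row (2) cone road of LH4-p07 (g9) (SCOPE (T5-P-cone) v1 §2 (R2); dealer∕pen LH4-plan (g13) WORD #60 (a)):
(T5-P-coneΔ-R2)-Unr «THE TYPE-U TORIC CENSUS SUM MINUS THE CUT TOP BAND».  2026-09-04.
-/
import Summits.HodgeConjecture.HodgeConjecture.Theorems.F0P3cDyRamToricCensusSumUnr   -- ★ T5s TYPE U `toricCensusSum_unr` (LH4-p04 (g3)); brings ★ FILE 1 `sum_range_window_reindex`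
import HarnessLib

/-!
# Crux `H413`, line LH4 «(D-RAM) FOUR-FRAME» — STAGE-1b, row (2): (T5-P-coneΔ-R2)-Unr «THE TYPE-U TORIC CENSUS SUM MINUS THE CUT TOP BAND»
# `ε·Σ_{j ≤ jl} Σ_a [j + a ≤ C]·q^a (dep₊(j,a) − dep₋(j,a)) = q^m·(N_V − 2[S]_q) − (cut `+` top band) − (cut `−` top band)`,  `jl ≤ C`

Cell `hodgecm-mathlib` (D-0151), FLOOR 0, crux item H413 = `stmt-HodgeConjecture-24833`, route of record `HCCMUnconditional`; squad F0∕P3c∕LH4 (req618∕req620); helper lane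
`--supports stmt-HodgeConjecture-24833 --as helper` (count-neutral).  THEOREMS ONLY (no `def`, no instance, no notation, no `sorry`; default heartbeats).  Pure finite-sum
bookkeeping over `ℚ` (no lattices), an ABSTRACT-TABLE lemma over ★ `toricCensusSum_unr` + its `hvTop` letters with ONE free cutoff constant `C`.

WHAT.  ★ p859713 `F0P3cDyRamJointProfileCensusCutoff` (LH4-p07 (g9), (T5-P-cut)) reads the `G`-side census of a LEVEL template piece `lev_{a′,b′}` at one literal as the
UNIT-type one-multiplier census (★ T5s currency) in the tokens `(m, jl) := (m − a′, jl − a′)` of the shallower multiplier `μ₁`, with the rows capped at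
`J′ = min(jl − a′, jl + n − b′)` and the cone cells (`a ≥ 1`) capped along the diagonal `j + a ≤ C`, `C = m + jl − b′` (lam-tokens) `= m₁ + jl₁ − (b′ − 2a′)`.  Near `γ_H = 1`
the tokens `m, jl, n, nν → ∞` with fixed offsets, so the row cap is IDLE (`J′ = jl₁` once `n ≥ b′ − a′`) and the diagonal cap sits at a FIXED offset `δ = b′ − 2a′ > 0` below
`m₁ + jl₁`; `jl₁ ≤ C` once `m₁ ≥ δ` — regime (R2) of LH4-p07's SCOPE (T5-P-cone) v1 §2.  Under `jl ≤ C` every off-diagonal ∕ LOW cell (`j + a ≤ jl`) survives and ONLY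
the TOP diagonal cells `j + a = jl + 2a − m > C` are cut, so the capped sum is ★ T5s minus two geometric tail blocks on the SAME column window `a ∈ [a₀, m)`,
`a₀ := (C + m − jl)∕2 + 1`:
* `cutP_eval` — the cut `+` cells: `Σ_j Σ_a [¬(j + a ≤ C)]·x^a·vP j a = [m + d ≤ jl ∧ jl − m − d even]·(x+1)·x^{a₀ + d + (jl−m−d)∕2 + ⌊m∕2⌋ − 1}·[m − a₀]_x`
  (each top `+` cell of column `a` is worth `(x+1)x^{a + d + (jl−m−d)∕2 + ⌊m∕2⌋ − 1}`, ★ `colP_eval`'s value; `hvOff` kills every off-diagonal cell above `jl`);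
* `cutM_eval` — the cut `−` cells: `… x^a·vM j a = [jl + 1 = d + m]·(x+1)·x^{a₀ + d + m − ⌊m∕2⌋ − 2}·[m − a₀]_x` (★ `rowM_eval`'s top value `(x+1)x^{j + m − ⌊m∕2⌋ − 1}`, `j = a + d − 1`);
* **`toricCensusSum_unr_cutoff`** — ★ `toricCensusSum_unr`'s binders VERBATIM + `(hC : jl ≤ C)`: `ε·Σ_j Σ_a [j + a ≤ C]·q^a (vP − vM) = ★ T5s value − cutP − cutM`
  (on the realizable token set exactly one band indicator fires: `ε = 1` kills the `−` band, `ε = −1` the `+` band, whence `−ε·(cutP − cutM) = −cutP − cutM`).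
ℕ-truncation makes both bands `0` when `C ≥ jl + m − 2` (nothing cut: ★ T5s verbatim, regime (R0)) and the whole top bands at `C = jl` (`a₀ = ⌊m∕2⌋ + 1`).  The axis column
`a = 0` is never cut (`j ≤ jl ≤ C`), as in ★ p859713 (its h∕h′ difference is LH4-p07's ★ p859631).  END signature `F0/P3c/LH4/LH4-p08/g8/SIG-coneR2-Unr.v2` («=» LH4-p07 (g9)
11:26:27Z with (i) the ★ p859753 summand shape, (ii) `hreal` kept, (iii) `jl ≤ C` = the near-1 letter `b′ − a′ ≤ m`).
HONEST LABEL.  Count-neutral (`--supports`): nothing printed is asserted; no census LAW is stated (the tables are hypotheses, welded to the lattice counts by ★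
`toricCensusSum_unr_weld`'s letters); pays no registered stub and touches no `Lines/` module; the seven tier-0 ED. 5 sorries stay OPEN; `HC_CM` is proved only modulo the 7
printed citations (2 remaining named inputs: hLiu418 = `stmt-HodgeConjecture-24832`, h413 = `stmt-HodgeConjecture-24833`) until rung 0 closes.

## References
* [Kottwitz1986BaseChangeUnits] R. E. Kottwitz, *Base change for unit elements of Hecke algebras*, Compositio Math. 60 (1986), §1 pp. 240–241 (orbital integrals of units as
  lattice counts modulo the torus).
* [Rogawski1990] J. D. Rogawski, *Automorphic Representations of Unitary Groups in Three Variables*, Ann. of Math. Stud. 123 (1990), §4.9 Prop. 4.9.1 (b) p. 55, Lemma 4.9.3 p. 56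
  (the fixed-point census of a type-(2) element; the toric decomposition).
* [Flicker1998UnitaryFL] Y. Z. Flicker, *Elementary proof of the fundamental lemma for a unitary group*, Canad. J. Math. 50 (1998), Prop. 7 p. 84 (the level tables).
-/

set_option autoImplicit false

namespace Summit.HodgeConjecture.HodgeConjecture.Cruxes.H413.F0P3cDyRamToricCensusSumUnrCutoff

open Finset
open Summit.HodgeConjecture.HodgeConjecture.Cruxes.H413.F0P3cDyRamToricCensusSumUnrBlocks
open Summit.HodgeConjecture.HodgeConjecture.Cruxes.H413.F0P3cDyRamToricCensusSumUnr

/-! ## §1 The cut cells: only the TOP diagonal cells lie above a cutoff `C ≥ jl` -/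

/-- **THE CUT `+` CELLS.**  Above a cutoff `C ≥ jl` the `+` side of the type-U census has only TOP diagonal cells (`j = jl + a − m`, `m < 2a < 2m`, top bit `d + m ≤ jl`,
parity `jl − m − d` even), each worth `(x+1)·x^{a + d + (jl−m−d)∕2 + ⌊m∕2⌋ − 1}` (★ `colP_eval`); they are cut iff `jl + 2a − m > C`, i.e. on the column window `a ∈ [a₀, m)`,
`a₀ = (C + m − jl)∕2 + 1` — a geometric block. [folklore] -/
theorem cutP_eval (x : ℚ) (hx0 : x ≠ 0) (hx1 : x ≠ 1) {d jl m C : ℕ} (hd : 2 ≤ d) (hm : m ≤ jl) (hC : jl ≤ C)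
    (nP vP : ℕ → ℕ → ℚ)
    (hnP : ∀ j a, 1 ≤ a → nP j a = if a + d ≤ j ∧ (j - a - d) % 2 = 0 then (x ^ 2 - 1) * x ^ (j - 2 - (j - a - d) / 2) else 0)
    (hvOffP : ∀ j a, 1 ≤ a → j + m ≠ jl + a → vP j a = if 2 * a ≤ m ∧ (j + a ≤ m ∨ j + a ≤ jl) then nP j a else 0)
    (hvTopP : ∀ j a, 1 ≤ a → j + m = jl + a → m < 2 * a →
      vP j a = if d + m ≤ jl ∧ j < jl then nP j a / ((x - 1) * x ^ ((2 * a - m + 1) / 2 - 1)) else 0) :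
    ∑ j ∈ range (jl + 1), ∑ a ∈ range (jl + 2), (if j + a ≤ C then 0 else x ^ a * vP j a) =
      if m + d ≤ jl ∧ (jl - m - d) % 2 = 0 then
        (x + 1) * x ^ (((C + m - jl) / 2 + 1) + d + (jl - m - d) / 2 + m / 2 - 1) * ∑ i ∈ range (m - ((C + m - jl) / 2 + 1)), x ^ i
      else 0 := by
  -- (1) above the cutoff only the TOP diagonal cells are alive
  have hcell : ∀ j ∈ range (jl + 1), ∀ a ∈ range (jl + 2), (if j + a ≤ C then (0 : ℚ) else x ^ a * vP j a) =
      if j = jl + a - m then (if ¬ (j + a ≤ C) then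
        x ^ a * (if d + m ≤ jl ∧ j < jl then nP j a / ((x - 1) * x ^ ((2 * a - m + 1) / 2 - 1)) else 0) else 0) else 0 := by
    intro j hj a _
    have hjr := Finset.mem_range.1 hj
    by_cases hc : j + a ≤ C
    · rw [if_pos hc]
      by_cases hj : j = jl + a - m
      · rw [if_pos hj, if_neg (not_not.2 hc)]
      · rw [if_neg hj]
    · rw [if_neg hc]
      have ha1 : 1 ≤ a := by omega
      by_cases hdiag : j + m = jl + a
      · rw [if_pos (show j = jl + a - m by omega), if_pos hc, hvTopP j a ha1 hdiag (by omega)]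
      · rw [hvOffP j a ha1 hdiag, if_neg (by omega), mul_zero, if_neg (show ¬ (j = jl + a - m) from fun h => hdiag (by omega))]
  rw [Finset.sum_congr rfl (fun j hj => Finset.sum_congr rfl (fun a ha => hcell j hj a ha)), Finset.sum_comm]
  simp_rw [Finset.sum_ite_eq' (range (jl + 1))]
  -- (2) per column: the cut top cell, in window form
  have hwin : ∀ a ∈ range (jl + 2),
      (if jl + a - m ∈ range (jl + 1) then
        (if ¬ (jl + a - m + a ≤ C) then
          x ^ a * (if d + m ≤ jl ∧ jl + a - m < jl then nP (jl + a - m) a / ((x - 1) * x ^ ((2 * a - m + 1) / 2 - 1)) else 0) else 0) else 0) =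
      if (C + m - jl) / 2 + 1 ≤ a ∧ a < (C + m - jl) / 2 + 1 + (m - ((C + m - jl) / 2 + 1)) then
        (if m + d ≤ jl ∧ (jl - m - d) % 2 = 0 then (x + 1) * x ^ (a + d + (jl - m - d) / 2 + m / 2 - 1) else 0) else 0 := by
    intro a _
    by_cases hw : (C + m - jl) / 2 + 1 ≤ a ∧ a < m
    · have ha1 : 1 ≤ a := by omega
      have hmem : jl + a - m ∈ range (jl + 1) := Finset.mem_range.2 (by omega)
      have hcutc : ¬ (jl + a - m + a ≤ C) := by omega
      rw [if_pos hmem, if_pos hcutc, if_pos (show (C + m - jl) / 2 + 1 ≤ a ∧ a < (C + m - jl) / 2 + 1 + (m - ((C + m - jl) / 2 + 1)) from ⟨hw.1, by omega⟩)]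
      by_cases htop : m + d ≤ jl ∧ (jl - m - d) % 2 = 0
      · rw [if_pos (show d + m ≤ jl ∧ jl + a - m < jl from ⟨by omega, by omega⟩), if_pos htop, hnP _ a ha1, if_pos ⟨by omega, by omega⟩]
        have hden : (x - 1) * x ^ ((2 * a - m + 1) / 2 - 1) ≠ 0 := mul_ne_zero (sub_ne_zero.2 hx1) (pow_ne_zero _ hx0)
        rw [← mul_div_assoc, div_eq_iff hden]
        have e : a + (jl + a - m - 2 - (jl + a - m - a - d) / 2) = (a + d + (jl - m - d) / 2 + m / 2 - 1) + ((2 * a - m + 1) / 2 - 1) := by omega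
        calc x ^ a * ((x ^ 2 - 1) * x ^ (jl + a - m - 2 - (jl + a - m - a - d) / 2))
            = (x ^ 2 - 1) * x ^ (a + (jl + a - m - 2 - (jl + a - m - a - d) / 2)) := by rw [pow_add]; ring
          _ = (x ^ 2 - 1) * (x ^ (a + d + (jl - m - d) / 2 + m / 2 - 1) * x ^ ((2 * a - m + 1) / 2 - 1)) := by rw [e, pow_add]
          _ = (x + 1) * x ^ (a + d + (jl - m - d) / 2 + m / 2 - 1) * ((x - 1) * x ^ ((2 * a - m + 1) / 2 - 1)) := by ring
      · rw [if_neg htop]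
        by_cases htb : d + m ≤ jl ∧ jl + a - m < jl
        · rw [if_pos htb, hnP _ a ha1, if_neg (fun h => htop ⟨by omega, by omega⟩), zero_div, mul_zero]
        · rw [if_neg htb, mul_zero]
    · rw [if_neg (show ¬ ((C + m - jl) / 2 + 1 ≤ a ∧ a < (C + m - jl) / 2 + 1 + (m - ((C + m - jl) / 2 + 1))) from fun h => hw ⟨h.1, by omega⟩)]
      by_cases hmem : jl + a - m ∈ range (jl + 1)
      · rw [if_pos hmem]
        have hmem' := Finset.mem_range.1 hmem
        by_cases hcutc : ¬ (jl + a - m + a ≤ C)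
        · rw [if_pos hcutc, if_neg (show ¬ (d + m ≤ jl ∧ jl + a - m < jl) from fun h => hw ⟨by omega, by omega⟩), mul_zero]
        · rw [if_neg hcutc]
      · rw [if_neg hmem]
  rw [Finset.sum_congr rfl hwin]
  -- (3) the window, re-indexed (empty when nothing is cut)
  by_cases hne : (C + m - jl) / 2 + 1 < m
  · rw [sum_range_window_reindex _ (by omega : (C + m - jl) / 2 + 1 + (m - ((C + m - jl) / 2 + 1)) ≤ jl + 2)]
    by_cases htop : m + d ≤ jl ∧ (jl - m - d) % 2 = 0
    · simp_rw [if_pos htop]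
      rw [Finset.mul_sum]
      refine Finset.sum_congr rfl fun i _ => ?_
      have e : (C + m - jl) / 2 + 1 + i + d + (jl - m - d) / 2 + m / 2 - 1 = ((C + m - jl) / 2 + 1 + d + (jl - m - d) / 2 + m / 2 - 1) + i := by omega
      rw [e, pow_add]; ring
    · simp_rw [if_neg htop]
      rw [Finset.sum_const_zero]
  · rw [Finset.sum_eq_zero (fun a _ => by rw [if_neg (by omega)]), show m - ((C + m - jl) / 2 + 1) = 0 by omega, Finset.range_zero,
      Finset.sum_empty, mul_zero]
    split_ifs <;> rfl

/-- **THE CUT `−` CELLS.**  Above a cutoff `C ≥ jl` the `−` side has only the TOP cells of the `−` diagonal (`jl + 1 = d + m`, `j = a + d − 1`, `m < 2a < 2m`), each worth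
`(x+1)·x^{a + d + m − ⌊m∕2⌋ − 2}` (★ `rowM_eval`); cut on the same column window `a ∈ [a₀, m)`, `a₀ = (C + m − jl)∕2 + 1`. [folklore] -/
theorem cutM_eval (x : ℚ) (hx0 : x ≠ 0) {d jl m C : ℕ} (hd : 2 ≤ d) (hm : m ≤ jl) (hC : jl ≤ C)
    (nM vM : ℕ → ℕ → ℚ)
    (hnM : ∀ j a, nM j a = if (d ≤ j + 1 ∧ a + d = j + 1) ∨ (j + 1 < d ∧ a = 0 ∧ (j + d) % 2 = 1) then
      (if j = 0 then (1 : ℚ) else (x + 1) * x ^ (j - 1)) else 0)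
    (hvOffM : ∀ j a, 1 ≤ a → j + m ≠ jl + a → vM j a = if 2 * a ≤ m ∧ (j + a ≤ m ∨ j + a ≤ jl) then nM j a else 0)
    (hvTopM : ∀ j a, 1 ≤ a → j + m = jl + a → m < 2 * a → vM j a = if jl + 1 = d + m ∧ j < jl then nM j a / x ^ ((2 * a - m) / 2) else 0) :
    ∑ j ∈ range (jl + 1), ∑ a ∈ range (jl + 2), (if j + a ≤ C then 0 else x ^ a * vM j a) =
      if jl + 1 = d + m then
        (x + 1) * x ^ (((C + m - jl) / 2 + 1) + d + m - m / 2 - 2) * ∑ i ∈ range (m - ((C + m - jl) / 2 + 1)), x ^ i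
      else 0 := by
  -- (1) above the cutoff only the TOP diagonal cells are alive
  have hcell : ∀ j ∈ range (jl + 1), ∀ a ∈ range (jl + 2), (if j + a ≤ C then (0 : ℚ) else x ^ a * vM j a) =
      if j = jl + a - m then (if ¬ (j + a ≤ C) then
        x ^ a * (if jl + 1 = d + m ∧ j < jl then nM j a / x ^ ((2 * a - m) / 2) else 0) else 0) else 0 := by
    intro j hj a _
    have hjr := Finset.mem_range.1 hj
    by_cases hc : j + a ≤ C
    · rw [if_pos hc]
      by_cases hj : j = jl + a - m
      · rw [if_pos hj, if_neg (not_not.2 hc)]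
      · rw [if_neg hj]
    · rw [if_neg hc]
      have ha1 : 1 ≤ a := by omega
      by_cases hdiag : j + m = jl + a
      · rw [if_pos (show j = jl + a - m by omega), if_pos hc, hvTopM j a ha1 hdiag (by omega)]
      · rw [hvOffM j a ha1 hdiag, if_neg (by omega), mul_zero, if_neg (show ¬ (j = jl + a - m) from fun h => hdiag (by omega))]
  rw [Finset.sum_congr rfl (fun j hj => Finset.sum_congr rfl (fun a ha => hcell j hj a ha)), Finset.sum_comm]
  simp_rw [Finset.sum_ite_eq' (range (jl + 1))]
  -- (2) per column: the cut top cell, in window form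
  have hwin : ∀ a ∈ range (jl + 2),
      (if jl + a - m ∈ range (jl + 1) then
        (if ¬ (jl + a - m + a ≤ C) then
          x ^ a * (if jl + 1 = d + m ∧ jl + a - m < jl then nM (jl + a - m) a / x ^ ((2 * a - m) / 2) else 0) else 0) else 0) =
      if (C + m - jl) / 2 + 1 ≤ a ∧ a < (C + m - jl) / 2 + 1 + (m - ((C + m - jl) / 2 + 1)) then
        (if jl + 1 = d + m then (x + 1) * x ^ (a + d + m - m / 2 - 2) else 0) else 0 := by
    intro a _
    by_cases hw : (C + m - jl) / 2 + 1 ≤ a ∧ a < m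
    · have ha1 : 1 ≤ a := by omega
      have hmem : jl + a - m ∈ range (jl + 1) := Finset.mem_range.2 (by omega)
      have hcutc : ¬ (jl + a - m + a ≤ C) := by omega
      rw [if_pos hmem, if_pos hcutc, if_pos (show (C + m - jl) / 2 + 1 ≤ a ∧ a < (C + m - jl) / 2 + 1 + (m - ((C + m - jl) / 2 + 1)) from ⟨hw.1, by omega⟩)]
      by_cases htop : jl + 1 = d + m
      · rw [if_pos (show jl + 1 = d + m ∧ jl + a - m < jl from ⟨htop, by omega⟩), if_pos htop, hnM,
          if_pos (Or.inl ⟨by omega, by omega⟩), if_neg (show ¬ (jl + a - m = 0) by omega), ← mul_div_assoc, div_eq_iff (pow_ne_zero _ hx0)]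
        have e : a + (jl + a - m - 1) = (a + d + m - m / 2 - 2) + (2 * a - m) / 2 := by omega
        calc x ^ a * ((x + 1) * x ^ (jl + a - m - 1)) = (x + 1) * x ^ (a + (jl + a - m - 1)) := by rw [pow_add]; ring
          _ = (x + 1) * x ^ (a + d + m - m / 2 - 2) * x ^ ((2 * a - m) / 2) := by rw [e, pow_add]; ring
      · rw [if_neg htop, if_neg (show ¬ (jl + 1 = d + m ∧ jl + a - m < jl) from fun h => htop h.1), mul_zero]
    · rw [if_neg (show ¬ ((C + m - jl) / 2 + 1 ≤ a ∧ a < (C + m - jl) / 2 + 1 + (m - ((C + m - jl) / 2 + 1))) from fun h => hw ⟨h.1, by omega⟩)]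
      by_cases hmem : jl + a - m ∈ range (jl + 1)
      · rw [if_pos hmem]
        have hmem' := Finset.mem_range.1 hmem
        by_cases hcutc : ¬ (jl + a - m + a ≤ C)
        · rw [if_pos hcutc, if_neg (show ¬ (jl + 1 = d + m ∧ jl + a - m < jl) from fun h => hw ⟨by omega, by omega⟩), mul_zero]
        · rw [if_neg hcutc]
      · rw [if_neg hmem]
  rw [Finset.sum_congr rfl hwin]
  -- (3) the window, re-indexed (empty when nothing is cut)
  by_cases hne : (C + m - jl) / 2 + 1 < m
  · rw [sum_range_window_reindex _ (by omega : (C + m - jl) / 2 + 1 + (m - ((C + m - jl) / 2 + 1)) ≤ jl + 2)]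
    by_cases htop : jl + 1 = d + m
    · simp_rw [if_pos htop]
      rw [Finset.mul_sum]
      refine Finset.sum_congr rfl fun i _ => ?_
      have e : (C + m - jl) / 2 + 1 + i + d + m - m / 2 - 2 = ((C + m - jl) / 2 + 1 + d + m - m / 2 - 2) + i := by omega
      rw [e, pow_add]; ring
    · simp_rw [if_neg htop]
      rw [Finset.sum_const_zero]
  · rw [Finset.sum_eq_zero (fun a _ => by rw [if_neg (by omega)]), show m - ((C + m - jl) / 2 + 1) = 0 by omega, Finset.range_zero,
      Finset.sum_empty, mul_zero]
    split_ifs <;> rfl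

/-! ## §2 The capped census sum -/

/-- **(T5-P-coneΔ-R2)-Unr — THE TYPE-U TORIC CENSUS SUM MINUS THE CUT TOP BAND.**  With the tables `nP nM vP vM` of ★ `toricCensusSum_unr` (u-free level tables of
type U and the depth rules at the tokens `(m, ε)`; `jl` even, `d ≥ 2`, realizable token set) and a cutoff `C ≥ jl` on the cone cells (`a ≥ 1`; the axis column `a = 0` exempt):
`ε·Σ_{j ≤ jl} Σ_a [j + a ≤ C]·q^a (vP j a − vM j a) = q^m·(N_V − 2[S]_q) − [m + d ≤ jl, jl−m−d even]·(q+1)q^{a₀ + d + (jl−m−d)∕2 + ⌊m∕2⌋ − 1}·[m − a₀]_q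
− [jl + 1 = d + m]·(q+1)q^{a₀ + d + m − ⌊m∕2⌋ − 2}·[m − a₀]_q`, `a₀ = (C + m − jl)∕2 + 1`, `N_V = 1 + (q+1)[n_H]_q`, `n_H = (jl + S − 2)∕2`, `S = d − d%2` — the level-piece
census of ★ p859713 in the tokens of its shallower multiplier, near `1` (row cap idle, diagonal cap `C = m + jl − (b′ − 2a′)`).  `C ≥ jl + m − 2`: nothing cut, ★ T5s verbatim.
[cite: Kottwitz1986BaseChangeUnits, §1 pp. 240–241] [cite: Rogawski1990, §4.9 Prop. 4.9.1 (b) p. 55, Lemma 4.9.3 p. 56] [cite: Flicker1998UnitaryFL, Prop. 7 p. 84] -/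
theorem toricCensusSum_unr_cutoff (q : ℕ) {d jl m : ℕ} (ε : ℚ) (hq : 2 ≤ q) (hd : 2 ≤ d) (hjl : jl % 2 = 0)
    (hreal : (ε = 1 ∧ m % 2 = d % 2 ∧ 1 ≤ m ∧ m + d ≤ jl) ∨ (ε = -1 ∧ m = jl - d + 1 ∧ d ≤ jl))
    (nP nM vP vM : ℕ → ℕ → ℚ)
    (hnP : ∀ j a, 1 ≤ a → nP j a = if a + d ≤ j ∧ (j - a - d) % 2 = 0 then ((q : ℚ) ^ 2 - 1) * (q : ℚ) ^ (j - 2 - (j - a - d) / 2) else 0)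
    (hnP0 : ∀ j, nP j 0 = if (j + d) % 2 = 0 then (if d ≤ j then ((q : ℚ) + 1) * (q : ℚ) ^ ((j + d) / 2 - 1) else (if j = 0 then 1 else ((q : ℚ) + 1) * (q : ℚ) ^ (j - 1))) else 0)
    (hnM : ∀ j a, nM j a = if (d ≤ j + 1 ∧ a + d = j + 1) ∨ (j + 1 < d ∧ a = 0 ∧ (j + d) % 2 = 1) then (if j = 0 then 1 else ((q : ℚ) + 1) * (q : ℚ) ^ (j - 1)) else 0)
    (hv0 : ∀ j, vP j 0 = nP j 0 ∧ vM j 0 = nM j 0)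
    (hvOff : ∀ j a, 1 ≤ a → j + m ≠ jl + a →
      (vP j a = if 2 * a ≤ m ∧ (j + a ≤ m ∨ j + a ≤ jl) then nP j a else 0) ∧ (vM j a = if 2 * a ≤ m ∧ (j + a ≤ m ∨ j + a ≤ jl) then nM j a else 0))
    (hvLow : ∀ j a, 1 ≤ a → j + m = jl + a → 2 * a ≤ m → vP j a = nP j a ∧ vM j a = nM j a)
    (hvTopP : ∀ j a, 1 ≤ a → j + m = jl + a → m < 2 * a →
      vP j a = if d + m ≤ jl ∧ j < jl then nP j a / (((q : ℚ) - 1) * (q : ℚ) ^ ((2 * a - m + 1) / 2 - 1)) else 0)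
    (hvTopM : ∀ j a, 1 ≤ a → j + m = jl + a → m < 2 * a →
      vM j a = if jl + 1 = d + m ∧ j < jl then nM j a / (q : ℚ) ^ ((2 * a - m) / 2) else 0)
    (C : ℕ) (hC : jl ≤ C) :
    ε * ∑ j ∈ range (jl + 1), ∑ a ∈ range (jl + 2), (q : ℚ) ^ a * (if j + a ≤ C then vP j a - vM j a else 0) =
      (q : ℚ) ^ m * ((1 + ((q : ℚ) + 1) * ∑ i ∈ range ((jl + (d - d % 2) - 2) / 2), (q : ℚ) ^ i) - 2 * ∑ i ∈ range (d - d % 2), (q : ℚ) ^ i)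
      - (if m + d ≤ jl ∧ (jl - m - d) % 2 = 0 then
          ((q : ℚ) + 1) * (q : ℚ) ^ (((C + m - jl) / 2 + 1) + d + (jl - m - d) / 2 + m / 2 - 1) * ∑ i ∈ range (m - ((C + m - jl) / 2 + 1)), (q : ℚ) ^ i
        else 0)
      - (if jl + 1 = d + m then
          ((q : ℚ) + 1) * (q : ℚ) ^ (((C + m - jl) / 2 + 1) + d + m - m / 2 - 2) * ∑ i ∈ range (m - ((C + m - jl) / 2 + 1)), (q : ℚ) ^ i
        else 0) := by
  have hx0 : (q : ℚ) ≠ 0 := Nat.cast_ne_zero.2 (by omega)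
  have hx1 : (q : ℚ) ≠ 1 := by exact_mod_cast (show q ≠ 1 by omega)
  have hm : m ≤ jl := by
    rcases hreal with ⟨-, -, -, h⟩ | ⟨-, h, h'⟩ <;> omega
  -- ★ T5s on the whole table
  have hT := toricCensusSum_unr q ε hq hd hjl hreal nP nM vP vM hnP hnP0 hnM hv0 hvOff hvLow hvTopP hvTopM
  -- split the whole table along the cutoff
  have hsplit : ∑ j ∈ range (jl + 1), ∑ a ∈ range (jl + 2), (q : ℚ) ^ a * (vP j a - vM j a) =
      ∑ j ∈ range (jl + 1), ∑ a ∈ range (jl + 2), (q : ℚ) ^ a * (if j + a ≤ C then vP j a - vM j a else 0) +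
        ∑ j ∈ range (jl + 1), ∑ a ∈ range (jl + 2), (if j + a ≤ C then 0 else (q : ℚ) ^ a * (vP j a - vM j a)) := by
    rw [← Finset.sum_add_distrib]
    refine Finset.sum_congr rfl fun j _ => ?_
    rw [← Finset.sum_add_distrib]
    refine Finset.sum_congr rfl fun a _ => ?_
    by_cases h : j + a ≤ C
    · rw [if_pos h, if_pos h, add_zero]
    · rw [if_neg h, if_neg h, mul_zero, zero_add]
  -- the cut part is `cutP − cutM`
  have hP := cutP_eval (q : ℚ) hx0 hx1 hd hm hC nP vP hnP (fun j a ha hne => (hvOff j a ha hne).1) hvTopP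
  have hM := cutM_eval (q : ℚ) hx0 hd hm hC nM vM hnM (fun j a ha hne => (hvOff j a ha hne).2) hvTopM
  have hrem : ∑ j ∈ range (jl + 1), ∑ a ∈ range (jl + 2), (if j + a ≤ C then 0 else (q : ℚ) ^ a * (vP j a - vM j a)) =
      ∑ j ∈ range (jl + 1), ∑ a ∈ range (jl + 2), (if j + a ≤ C then 0 else (q : ℚ) ^ a * vP j a) -
        ∑ j ∈ range (jl + 1), ∑ a ∈ range (jl + 2), (if j + a ≤ C then 0 else (q : ℚ) ^ a * vM j a) := by
    rw [← Finset.sum_sub_distrib]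
    refine Finset.sum_congr rfl fun j _ => ?_
    rw [← Finset.sum_sub_distrib]
    refine Finset.sum_congr rfl fun a _ => ?_
    split_ifs <;> ring
  rw [hsplit, hrem, hP, hM] at hT
  -- on the realizable set exactly one band fires
  rcases hreal with ⟨hε, -, -, hmd⟩ | ⟨hε, hmeq, -⟩
  · subst hε
    rw [if_neg (show ¬ (jl + 1 = d + m) by omega)] at hT ⊢
    linear_combination hT
  · subst hε
    rw [if_neg (show ¬ (m + d ≤ jl ∧ (jl - m - d) % 2 = 0) from fun h => by omega)] at hT ⊢
    linear_combination hT

end Summit.HodgeConjecture.HodgeConjecture.Cruxes.H413.F0P3cDyRamToricCensusSumUnrCutoff
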